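import Summits.QuantumFields.YangMills.Theorems.LuscherReductionDressedRitzLiftLeakageDressedSectorsForms
import Summits.QuantumFields.YangMills.Theorems.LuscherReductionDressedRitzLiftLeakageResidual
import Summits.QuantumFields.YangMills.Theorems.LuscherReductionDressedRitzPolyakovLiftDressed
import Mathlib.Analysis.SpecialFunctions.Pow.Asymptotics
import HarnessLib

/-!
# Crux `DressedRitz` (stmt-QuantumFields-20205), line «polyakovlift» r5, stub S-LEAK `stub_liftLeakage` — support XI-b:
# the exact spectral bookkeeping of TIME-DRESSING for the leakage clause (o4): sectors of the dressed residual; the hard sector is free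

Support module (fleet seat ym-20205-polyakovlift-s1 gen 1; `--supports stmt-QuantumFields-20205`, helper, no closure claim) for the registered stub
`Summit.QuantumFields.YangMills.Cruxes.DressedRitz.PolyakovLift.stub_liftLeakage` of skeleton r5 (lead ym-lead-20205-polyakovlift; sha16 8b6782afbcc2a19a):
clause (o4) `‖K_β u‖²‖u‖² − ⟨u,K_βu⟩² ≤ C(λ³/L²)λ₀²‖u‖⁴` for the TIME-DRESSED lifted channel vectors `u = K_β^[m] x` (`m = dressSteps L = L`,
`x = liftVec β φ g` the undressed flowed-Polyakov insertion state; tree `…PolyakovLiftDressed.lean`, p529179).  Femto instantiation of the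
operator-free layer XI-a (`…LiftLeakageDressedSectorsForms.lean`); no definition is introduced.

WHY THE DRESSING (lead's `HAZARD-S-LEAK-UV.md`, evidence #27 on the item; cdisprove g1 (G1-d′) concurs): the UNDRESSED insertion state carries
two-hard-gluon components of relative weight `≍ κλ⁴/L` at lattice-scale energies `E = O(1)` per transfer step, fatal for the centred second moment (o4)
at tolerance `Cλ³/L²`; `K_β^[L]` multiplies the weight of an exact level `λ_j = λ₀e^{−E_j}` by `λ_j^{2L}`, i.e. by `e^{−2L(E_j − E_own)}` RELATIVE to
the own level.  This file is that sentence, kernel-checked, as fixed-lattice functional analysis over the tree's physical subspace (`physSubmodule`,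
`l2Form`, `transferOp`; exact eigenfamilies from `LiftLeak.exists_eigenfamily_dominating`):

§B any physical `x`, `ψ_0 … ψ_{N−1}` an exact physical `l2`-orthonormal eigenfamily (levels `λ_j`), `r_N = x − Σ_j⟨x,ψ_j⟩ψ_j`:
* `l2_iterate_eigen` (`⟨K_β^[m]x,ψ⟩ = μ^m⟨x,ψ⟩`), ★ `residual_iterate_split_eigenfamily`
  (`‖(K_β−a)K_β^[m]x‖² = Σ_j (λ_j−a)²λ_j^{2m}⟨x,ψ_j⟩² + ‖(K_β−a)K_β^[m]r_N‖²`, EXACT), `normSq_iterate_split_eigenfamily`, `normSq_remainder_le`,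
  `normSq_iterate_ge_level` (`‖K_β^[m]x‖² ≥ λ_j^{2m}⟨x,ψ_j⟩²` for each `j`), `iterate_remainder_bounds` (domination at `Λ`:
  `‖K_β^[m]r_N‖² ≤ Λ^{2m}‖r_N‖²`, `‖(K_β−a)K_β^[m]r_N‖² ≤ max(a²,(Λ−a)²)Λ^{2m}‖r_N‖²`);
* ★★ `residual_iterate_le_of_sectors` — the RELATIVE squared residual of the dressed vector from UNDRESSED weights:
  `‖(K_β − a)K_β^[m]x‖² ≤ ρ‖K_β^[m]x‖²` as soon as, for some own index `j₀ < N`,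
  `Σ_{j<N} (λ_j − a)²·λ_j^{2m}·⟨x,ψ_j⟩² + max(a²,(Λ−a)²)·Λ^{2m}·‖x‖² ≤ ρ·λ_{j₀}^{2m}·⟨x,ψ_{j₀}⟩²`
  — dividing by `λ_{j₀}^{2m}`: the finitely many slow∕soft levels enter with the dressing factors `(λ_j/λ_{j₀})^{2m}` (`≤ 1` below the own level,
  `≤ e^{2λΔε}` = `O(1)` for the slower one-site-like levels), and the WHOLE dominated remainder (every fine state beyond level `N`, in particular every
  lattice-scale state) enters only through `(Λ/λ_{j₀})^{2m} ≤ e^{−2m·E}` (`pow_le_exp_mul_pow`) times its undressed weight `≤ ‖x‖²`;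
* ★★ `leakageClause_iterate_of_sectors` ∕ ★★★ `leakageClause_dressed_of_sectors` — press-buttons in the stub's currency: the VERBATIM
  `PolyakovLift.LeakageClause k C β (fun i => K_β^[m](x i))` ∕ `… (dressedLiftFamily β φ g)` from per-vector sector data of the undressed states;
  `residual_dressedLiftVec_le_of_sectors` — the per-vector hypothesis (RL) of the landed closing press-buttons IX (`liftLeakage_dressed_of_referenceLaw`,
  p532178) ∕ X (`residualLaw_allBases_of_reference_lift_width`, p533270) for ONE dressed reference lift, from undressed sector data.
§C the hard sector is free under the stub's quantifier order `∀ lam ∃ L0 ∀ L ≥ L0`: `exists_length_exp_le` (`e^{−2EL} ≤ c/L²` eventually),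
  ★ `hardSector_le_of_window` (in the window at level `lam`: `e^{−2EL}·X ≤ C(λ³/L²)·X` for `L ≥ L0(E,C,lam)`), `pow_le_exp_mul_pow`.

WHAT REMAINS for S-LEAK after XI (per dressed reference lift `v_n`, at the PF vacuum; feeds IX∕X unchanged): for the UNDRESSED reference insertion
state `x_n = liftVec β Ω (ψ_n/Ω₁)` against the exact FINE eigenbasis — an own fine level `j₀(n)` carrying weight `⟨x_n,ψ^f_{j₀}⟩² ≥ c·‖x_n‖²`
(first-moment statics), SLOW∕SOFT weights `⟨x_n,ψ^f_j⟩²` (`j < N`, outside the own cluster) of total size `O(λ)` at levers `(λ_j − a_n)² ≍ (λλ₀/L)²`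
resp. `O(λ³/L²)` at levers `≤ λ₀²`, for the finitely many fine levels within a FIXED energy `E` per step of the own level (the open
renormalisation-group ∕ Born–Oppenheimer estimate: first-order degenerate perturbation theory of the zero-mode sector) — and NOTHING on the fine states
more than `E` below (`hardSector_le_of_window`).  Not proved here; no claim on the stub.

HONEST FRAMING: fixed-lattice functional analysis on the conditional femto rung R2b1; `stub_liftLeakage` stays OPEN; nothing here bears on infinite
volume, the continuum limit or the Clay gap.
References: T. Kato, J. Phys. Soc. Japan 4 (1949) 334 [cite: Kato1949, §1]; M. Reed, B. Simon IV (1978) Thm XIII.1 [cite: ReedSimonIV1978];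
M. Lüscher, U. Wolff, NPB 339 (1990) 222 [cite: LuscherWolff1990, §2]; M. Lüscher, NPB 219 (1983) 233 [cite: Luscher1983, §3].
-/

set_option autoImplicit false

noncomputable section

open MeasureTheory Filter Topology Real Finset
open Literature.MathematicalPhysics.QuantumFieldTheory
open Literature.MathematicalPhysics.QuantumLattice
open Literature.Analysis.OperatorTheory
open scoped BigOperators

namespace Summit.QuantumFields.YangMills.Theorems.FemtoTransferGap.LiftLeak

/-! ## §B The femto transfer problem: dressed residuals against the physical eigenbasis -/

section Femto

variable {L : ℕ} [NeZero L]

/-- The iterated endomorphism `transferOp β` coerces to the iterated `transferApply β`. [folklore] -/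
theorem coe_iterate_transferOp (β : ℝ) (y : physSubmodule L) (m : ℕ) :
    (((transferOp β : physSubmodule L → physSubmodule L)^[m] y : physSubmodule L) : GaugeConfig 3 L SU2 → ℝ) =
      (transferApply (L := L) β)^[m] (y : GaugeConfig 3 L SU2 → ℝ) := by
  induction m with
  | zero => rfl
  | succ m ih => rw [Function.iterate_succ_apply', Function.iterate_succ_apply', coe_transferOp, ih]

/-- `⟨K_β^[m] x, ψ⟩ = μ^m ⟨x, ψ⟩` for physical `x`, `ψ` with `K_β ψ = μ ψ`. [cite: ReedSimonIV1978, Thm XIII.1] -/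
theorem l2_iterate_eigen (β : ℝ) {x ψ : GaugeConfig 3 L SU2 → ℝ} (hx : IsPhys x) (hψ : IsPhys ψ) {μ : ℝ}
    (heig : transferApply β ψ = μ • ψ) (m : ℕ) :
    l2 ((transferApply (L := L) β)^[m] x) ψ = μ ^ m * l2 x ψ := by
  have heig' : transferOp β (⟨ψ, hψ⟩ : physSubmodule L) = μ • (⟨ψ, hψ⟩ : physSubmodule L) :=
    Subtype.ext (by simpa only [coe_transferOp, Submodule.coe_smul] using heig)
  have h := ip_iterate_eigen (l2Form L) (transferOp β) (transferOp_symm β) heig' ⟨x, hx⟩ m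
  simpa only [l2Form_apply, coe_iterate_transferOp, Submodule.coe_mk] using h

/-- ★ **EXACT sector split of the dressed residual (femto).**  `ψ_0 … ψ_{N−1}` physical, `l2`-orthonormal, `K_β ψ_j = λ_j ψ_j`; `x` physical;
`r = x − Σ_j ⟨x,ψ_j⟩ψ_j`.  For every `a`, `m`:
`‖K_β(K_β^[m]x) − a·K_β^[m]x‖² = Σ_j (λ_j − a)²·λ_j^{2m}·⟨x,ψ_j⟩² + ‖K_β(K_β^[m]r) − a·K_β^[m]r‖²`. [cite: ReedSimonIV1978, Thm XIII.1] [cite: LuscherWolff1990, §2] -/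
theorem residual_iterate_split_eigenfamily (β : ℝ) {N : ℕ} {ψ : Fin N → (GaugeConfig 3 L SU2 → ℝ)} (hψ : ∀ j, IsPhys (ψ j))
    (hon : ∀ i l, l2 (ψ i) (ψ l) = if i = l then 1 else 0) (ev : Fin N → ℝ)
    (heig : ∀ j, transferApply β (ψ j) = ev j • ψ j) {x : GaugeConfig 3 L SU2 → ℝ} (hx : IsPhys x) (a : ℝ) (m : ℕ) :
    l2 (transferApply β ((transferApply β)^[m] x) - a • (transferApply β)^[m] x)
        (transferApply β ((transferApply β)^[m] x) - a • (transferApply β)^[m] x) =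
      ∑ j, (ev j - a) ^ 2 * ev j ^ (2 * m) * l2 x (ψ j) ^ 2 +
        l2 (transferApply β ((transferApply β)^[m] (x - ∑ j, l2 x (ψ j) • ψ j)) - a • (transferApply β)^[m] (x - ∑ j, l2 x (ψ j) • ψ j))
          (transferApply β ((transferApply β)^[m] (x - ∑ j, l2 x (ψ j) • ψ j)) - a • (transferApply β)^[m] (x - ∑ j, l2 x (ψ j) • ψ j)) := by
  set e : Fin N → physSubmodule L := fun j => ⟨ψ j, hψ j⟩ with he
  have hon' : ∀ i l, l2Form L (e i) (e l) = if i = l then 1 else 0 := fun i l => by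
    simpa only [l2Form_apply, he, Submodule.coe_mk] using hon i l
  have heig' : ∀ j, transferOp β (e j) = ev j • e j := fun j => by
    apply Subtype.ext
    simpa only [coe_transferOp, Submodule.coe_smul, he, Submodule.coe_mk] using heig j
  have h := residual_iterate_split (l2Form L) l2Form_symm (transferOp β) (transferOp_symm β) e ev hon' heig' ⟨x, hx⟩ a m
  simpa only [l2Form_apply, coe_transferOp, coe_iterate_transferOp, Submodule.coe_sub, Submodule.coe_sum, Submodule.coe_smul,
    Submodule.coe_mk, he] using h

/-- **Gram split of the dressed vector (femto)**: `‖K_β^[m]x‖² = Σ_j λ_j^{2m}⟨x,ψ_j⟩² + ‖K_β^[m]r‖²`. [cite: ReedSimonIV1978, Thm XIII.1] -/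
theorem normSq_iterate_split_eigenfamily (β : ℝ) {N : ℕ} {ψ : Fin N → (GaugeConfig 3 L SU2 → ℝ)} (hψ : ∀ j, IsPhys (ψ j))
    (hon : ∀ i l, l2 (ψ i) (ψ l) = if i = l then 1 else 0) (ev : Fin N → ℝ)
    (heig : ∀ j, transferApply β (ψ j) = ev j • ψ j) {x : GaugeConfig 3 L SU2 → ℝ} (hx : IsPhys x) (m : ℕ) :
    l2 ((transferApply β)^[m] x) ((transferApply β)^[m] x) =
      ∑ j, ev j ^ (2 * m) * l2 x (ψ j) ^ 2 +
        l2 ((transferApply β)^[m] (x - ∑ j, l2 x (ψ j) • ψ j)) ((transferApply β)^[m] (x - ∑ j, l2 x (ψ j) • ψ j)) := by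
  set e : Fin N → physSubmodule L := fun j => ⟨ψ j, hψ j⟩ with he
  have hon' : ∀ i l, l2Form L (e i) (e l) = if i = l then 1 else 0 := fun i l => by
    simpa only [l2Form_apply, he, Submodule.coe_mk] using hon i l
  have heig' : ∀ j, transferOp β (e j) = ev j • e j := fun j => by
    apply Subtype.ext
    simpa only [coe_transferOp, Submodule.coe_smul, he, Submodule.coe_mk] using heig j
  have h := normSq_iterate_split (l2Form L) l2Form_symm (transferOp β) (transferOp_symm β) e ev hon' heig' ⟨x, hx⟩ m
  simpa only [l2Form_apply, coe_transferOp, coe_iterate_transferOp, Submodule.coe_sub, Submodule.coe_sum, Submodule.coe_smul,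
    Submodule.coe_mk, he] using h

/-- **The norm of the undressed remainder is at most the norm**: `‖x − Σ_j⟨x,ψ_j⟩ψ_j‖² ≤ ‖x‖²`. [folklore] -/
theorem normSq_remainder_le {N : ℕ} {ψ : Fin N → (GaugeConfig 3 L SU2 → ℝ)} (hψ : ∀ j, IsPhys (ψ j))
    (hon : ∀ i l, l2 (ψ i) (ψ l) = if i = l then 1 else 0) {x : GaugeConfig 3 L SU2 → ℝ} (hx : IsPhys x) :
    l2 (x - ∑ j, l2 x (ψ j) • ψ j) (x - ∑ j, l2 x (ψ j) • ψ j) ≤ l2 x x := by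
  set e : Fin N → physSubmodule L := fun j => ⟨ψ j, hψ j⟩ with he
  have hon' : ∀ i l, l2Form L (e i) (e l) = if i = l then 1 else 0 := fun i l => by
    simpa only [l2Form_apply, he, Submodule.coe_mk] using hon i l
  have h := norm_split (l2Form L) l2Form_symm e hon' ⟨x, hx⟩
  simp only [l2Form_apply, Submodule.coe_sub, Submodule.coe_sum, Submodule.coe_smul, he] at h
  rw [h]
  have hs : 0 ≤ ∑ j, l2 x (ψ j) ^ 2 := sum_nonneg fun j _ => sq_nonneg _
  linarith

/-- ★ **The dressed norm dominates every single dressed level weight**: `‖K_β^[m]x‖² ≥ λ_{j}^{2m}·⟨x,ψ_{j}⟩²` for each `j`. [cite: ReedSimonIV1978, Thm XIII.1] -/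
theorem normSq_iterate_ge_level (β : ℝ) {N : ℕ} {ψ : Fin N → (GaugeConfig 3 L SU2 → ℝ)} (hψ : ∀ j, IsPhys (ψ j))
    (hon : ∀ i l, l2 (ψ i) (ψ l) = if i = l then 1 else 0) (ev : Fin N → ℝ)
    (heig : ∀ j, transferApply β (ψ j) = ev j • ψ j) {x : GaugeConfig 3 L SU2 → ℝ} (hx : IsPhys x) (m : ℕ) (j₀ : Fin N) :
    ev j₀ ^ (2 * m) * l2 x (ψ j₀) ^ 2 ≤ l2 ((transferApply β)^[m] x) ((transferApply β)^[m] x) := by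
  rw [normSq_iterate_split_eigenfamily β hψ hon ev heig hx m]
  have hterm : ∀ j, 0 ≤ ev j ^ (2 * m) * l2 x (ψ j) ^ 2 := fun j =>
    mul_nonneg (by rw [pow_mul']; exact sq_nonneg _) (sq_nonneg _)
  have h1 : ev j₀ ^ (2 * m) * l2 x (ψ j₀) ^ 2 ≤ ∑ j, ev j ^ (2 * m) * l2 x (ψ j) ^ 2 :=
    single_le_sum (f := fun j => ev j ^ (2 * m) * l2 x (ψ j) ^ 2) (fun j _ => hterm j) (mem_univ j₀)
  linarith [l2_self_nonneg ((transferApply β)^[m] (x - ∑ j, l2 x (ψ j) • ψ j))]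

/-- ★ **Dressing a dominated remainder (femto)**: if every physical `φ ⊥ ψ_0 … ψ_{N−1}` has `⟨φ,K_βφ⟩ ≤ Λ‖φ‖²` (`Λ ≥ 0`, `β ≥ 0`; Courant–Fischer
domination, `Λ = levelValue N` for the tree's eigenbasis), then for every physical `r ⊥ ψ`, every `a` and `m`:
`‖K_β^[m]r‖² ≤ Λ^{2m}‖r‖²` and `‖K_β(K_β^[m]r) − a·K_β^[m]r‖² ≤ max(a²,(Λ−a)²)·Λ^{2m}‖r‖²` — every state beyond level `N` is damped by `(Λ/·)^{2m}`.
[cite: ReedSimonIV1978, Thm XIII.1] -/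
theorem iterate_remainder_bounds {β : ℝ} (hβ : 0 ≤ β) {N : ℕ} {ψ : Fin N → (GaugeConfig 3 L SU2 → ℝ)} (hψ : ∀ j, IsPhys (ψ j))
    (ev : Fin N → ℝ) (heig : ∀ j, transferApply β (ψ j) = ev j • ψ j) {Λ : ℝ} (hΛ : 0 ≤ Λ)
    (hdom : ∀ φ : GaugeConfig 3 L SU2 → ℝ, IsPhys φ → (∀ j, l2 φ (ψ j) = 0) → l2 φ (transferApply β φ) ≤ Λ * l2 φ φ)
    {r : GaugeConfig 3 L SU2 → ℝ} (hr : IsPhys r) (hrψ : ∀ j, l2 r (ψ j) = 0) (a : ℝ) (m : ℕ) :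
    l2 ((transferApply β)^[m] r) ((transferApply β)^[m] r) ≤ Λ ^ (2 * m) * l2 r r ∧
      l2 (transferApply β ((transferApply β)^[m] r) - a • (transferApply β)^[m] r)
          (transferApply β ((transferApply β)^[m] r) - a • (transferApply β)^[m] r) ≤
        max (a ^ 2) ((Λ - a) ^ 2) * (Λ ^ (2 * m) * l2 r r) := by
  set e : Fin N → physSubmodule L := fun j => ⟨ψ j, hψ j⟩ with he
  have heig' : ∀ j, transferOp β (e j) = ev j • e j := fun j => by
    apply Subtype.ext
    simpa only [coe_transferOp, Submodule.coe_smul, he, Submodule.coe_mk] using heig j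
  set P : physSubmodule L → Prop := fun y => ∀ j, l2Form L y (e j) = 0 with hP
  have hPK : ∀ y, P y → P (transferOp β y) := fun y hy j =>
    ip_apply_eigen_eq_zero (l2Form L) (transferOp β) (transferOp_symm β) e ev heig' hy j
  have hdom' : ∀ y, P y → l2Form L y (transferOp β y) ≤ Λ * l2Form L y y := fun y hy => by
    simpa only [l2Form_apply, coe_transferOp] using
      hdom y (isPhys_coe y) (fun j => by simpa only [l2Form_apply, he, Submodule.coe_mk] using hy j)
  have hpos : ∀ y : physSubmodule L, 0 ≤ l2Form L y (transferOp β y) := l2Form_self_transferOp_nonneg hβ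
  have hrP : P ⟨r, hr⟩ := fun j => by simpa only [l2Form_apply, he, Submodule.coe_mk] using hrψ j
  have h1 := normSq_iterate_dom_le (l2Form L) l2Form_symm l2Form_self_nonneg (transferOp β) (transferOp_symm β) hpos P hPK hΛ
    hdom' hrP m
  have h2 := residual_iterate_remainder_le (l2Form L) l2Form_symm l2Form_self_nonneg (transferOp β) (transferOp_symm β) hpos P
    hPK hΛ hdom' hrP a m
  simp only [l2Form_apply, coe_transferOp, coe_iterate_transferOp, Submodule.coe_sub, Submodule.coe_smul] at h1 h2
  exact ⟨h1, h2⟩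

/-- ★★ **The relative squared residual of a DRESSED vector from UNDRESSED sector data.**  `ψ` an exact physical `l2`-orthonormal eigenfamily
(levels `λ_j`) dominating at `Λ ≥ 0`; `x` physical; own index `j₀`; if
`Σ_{j<N} (λ_j − a)²·λ_j^{2m}·⟨x,ψ_j⟩² + max(a²,(Λ−a)²)·Λ^{2m}·‖x‖² ≤ ρ·λ_{j₀}^{2m}·⟨x,ψ_{j₀}⟩²` (`ρ ≥ 0`), then
`‖K_β(K_β^[m]x) − a·K_β^[m]x‖² ≤ ρ·‖K_β^[m]x‖²`.  (Divide by `λ_{j₀}^{2m}`: the slow∕soft levels carry the dressing factors `(λ_j/λ_{j₀})^{2m}`, the whole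
remainder beyond level `N` carries `(Λ/λ_{j₀})^{2m}` times its undressed weight `≤ ‖x‖²`.) [cite: ReedSimonIV1978, Thm XIII.1] [cite: LuscherWolff1990, §2] -/
theorem residual_iterate_le_of_sectors {β : ℝ} (hβ : 0 ≤ β) {N : ℕ} {ψ : Fin N → (GaugeConfig 3 L SU2 → ℝ)} (hψ : ∀ j, IsPhys (ψ j))
    (hon : ∀ i l, l2 (ψ i) (ψ l) = if i = l then 1 else 0) (ev : Fin N → ℝ)
    (heig : ∀ j, transferApply β (ψ j) = ev j • ψ j) {Λ : ℝ} (hΛ : 0 ≤ Λ)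
    (hdom : ∀ φ : GaugeConfig 3 L SU2 → ℝ, IsPhys φ → (∀ j, l2 φ (ψ j) = 0) → l2 φ (transferApply β φ) ≤ Λ * l2 φ φ)
    {x : GaugeConfig 3 L SU2 → ℝ} (hx : IsPhys x) {a ρ : ℝ} (hρ : 0 ≤ ρ) (m : ℕ) (j₀ : Fin N)
    (h : ∑ j, (ev j - a) ^ 2 * ev j ^ (2 * m) * l2 x (ψ j) ^ 2 + max (a ^ 2) ((Λ - a) ^ 2) * (Λ ^ (2 * m) * l2 x x) ≤
      ρ * (ev j₀ ^ (2 * m) * l2 x (ψ j₀) ^ 2)) :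
    l2 (transferApply β ((transferApply β)^[m] x) - a • (transferApply β)^[m] x)
        (transferApply β ((transferApply β)^[m] x) - a • (transferApply β)^[m] x) ≤
      ρ * l2 ((transferApply β)^[m] x) ((transferApply β)^[m] x) := by
  set r := x - ∑ j, l2 x (ψ j) • ψ j with hr_def
  have hr : IsPhys r := by
    have hmem : r ∈ physSubmodule L := by
      rw [hr_def]
      exact Submodule.sub_mem _ hx (Submodule.sum_mem _ fun j _ => Submodule.smul_mem _ _ (hψ j))
    exact hmem
  have hrψ : ∀ j, l2 r (ψ j) = 0 := l2_remainder_eq_zero hψ hon hx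
  obtain ⟨-, hrem⟩ := iterate_remainder_bounds hβ hψ ev heig hΛ hdom hr hrψ a m
  have hrle : l2 r r ≤ l2 x x := normSq_remainder_le hψ hon hx
  have hmax : 0 ≤ max (a ^ 2) ((Λ - a) ^ 2) := le_max_of_le_left (sq_nonneg a)
  have hΛm : 0 ≤ Λ ^ (2 * m) := pow_nonneg hΛ _
  have hlev := normSq_iterate_ge_level β hψ hon ev heig hx m j₀
  calc l2 (transferApply β ((transferApply β)^[m] x) - a • (transferApply β)^[m] x)
        (transferApply β ((transferApply β)^[m] x) - a • (transferApply β)^[m] x)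
      = ∑ j, (ev j - a) ^ 2 * ev j ^ (2 * m) * l2 x (ψ j) ^ 2 +
          l2 (transferApply β ((transferApply β)^[m] r) - a • (transferApply β)^[m] r)
            (transferApply β ((transferApply β)^[m] r) - a • (transferApply β)^[m] r) :=
        residual_iterate_split_eigenfamily β hψ hon ev heig hx a m
    _ ≤ ∑ j, (ev j - a) ^ 2 * ev j ^ (2 * m) * l2 x (ψ j) ^ 2 + max (a ^ 2) ((Λ - a) ^ 2) * (Λ ^ (2 * m) * l2 r r) := by
        linarith [hrem]
    _ ≤ ∑ j, (ev j - a) ^ 2 * ev j ^ (2 * m) * l2 x (ψ j) ^ 2 + max (a ^ 2) ((Λ - a) ^ 2) * (Λ ^ (2 * m) * l2 x x) := by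
        linarith [mul_le_mul_of_nonneg_left (mul_le_mul_of_nonneg_left hrle hΛm) hmax]
    _ ≤ ρ * (ev j₀ ^ (2 * m) * l2 x (ψ j₀) ^ 2) := h
    _ ≤ ρ * l2 ((transferApply β)^[m] x) ((transferApply β)^[m] x) := mul_le_mul_of_nonneg_left hlev hρ

/-- ★★ **Press-button: (o4) for a dressed family from undressed sector data.**  `x_i` physical, `u_i = K_β^[m] x_i`, `C ≥ 0`, `β ≥ 0`; for each `i`
an exact physical `l2`-orthonormal eigenfamily `ψ` (levels `λ_j`) dominating at `Λ ≥ 0`, an approximate eigenvalue `a`, an own index `j₀` with the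
sector inequality of `residual_iterate_le_of_sectors` at `ρ = C(λ³/L²)λ₀²`.  Then the VERBATIM `PolyakovLift.LeakageClause k C β u`. [cite: Kato1949, §1] [cite: LuscherWolff1990, §2] -/
theorem leakageClause_iterate_of_sectors {k : ℕ} {C β : ℝ} (hβ : 0 ≤ β) (hC : 0 ≤ C) {x : Fin k → (GaugeConfig 3 L SU2 → ℝ)}
    (hx : ∀ i, IsPhys (x i)) (m : ℕ)
    (h : ∀ i : Fin k, ∃ (N : ℕ) (ψ : Fin N → (GaugeConfig 3 L SU2 → ℝ)) (ev : Fin N → ℝ) (Λ a : ℝ) (j₀ : Fin N),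
      (∀ j, IsPhys (ψ j)) ∧ (∀ j l, l2 (ψ j) (ψ l) = if j = l then 1 else 0) ∧
      (∀ j, transferApply β (ψ j) = ev j • ψ j) ∧ 0 ≤ Λ ∧
      (∀ φ : GaugeConfig 3 L SU2 → ℝ, IsPhys φ → (∀ j, l2 φ (ψ j) = 0) → l2 φ (transferApply β φ) ≤ Λ * l2 φ φ) ∧
      ∑ j, (ev j - a) ^ 2 * ev j ^ (2 * m) * l2 (x i) (ψ j) ^ 2 + max (a ^ 2) ((Λ - a) ^ 2) * (Λ ^ (2 * m) * l2 (x i) (x i)) ≤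
        C * (luscherLambda β L ^ 3 / (L : ℝ) ^ 2) * levelValue su2Rep L β 0 ^ 2 * (ev j₀ ^ (2 * m) * l2 (x i) (ψ j₀) ^ 2)) :
    PolyakovLift.LeakageClause k C β (fun i => (transferApply β)^[m] (x i)) := by
  have hρ : 0 ≤ C * (luscherLambda β L ^ 3 / (L : ℝ) ^ 2) * levelValue su2Rep L β 0 ^ 2 :=
    mul_nonneg (mul_nonneg hC (div_nonneg (pow_nonneg (by unfold luscherLambda; exact Real.rpow_nonneg (le_max_right _ _) _) 3) (sq_nonneg _))) (sq_nonneg _)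
  refine leakageClause_of_residual C β (fun i => isPhys_iterate_transferApply β (hx i) m) fun i => ?_
  obtain ⟨N, ψ, ev, Λ, a, j₀, hψ, hon, heig, hΛ, hdom, hle⟩ := h i
  exact ⟨a, residual_iterate_le_of_sectors hβ hψ hon ev heig hΛ hdom (hx i) hρ m j₀ hle⟩

end Femto

/-! ## §B′ The registered objects: the dressed lifted family `dressedLiftFamily β φ g = (K_β^[dressSteps L](liftVec β φ g_i))_i` -/

section Dressed

open Summit.QuantumFields.YangMills.Theorems.FemtoTransferGap.PolyakovLift

variable {L : ℕ} [NeZero L]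

/-- ★★★ **Press-button for the r3∕r5 S-LEAK family: `LeakageClause k C β (dressedLiftFamily β φ g)` from UNDRESSED sector data** of the lifted
insertion states `x_i = liftVec β φ g_i` (`φ` physical, `g_i` physical, `C ≥ 0`, `β ≥ 0`; hypothesis as in `leakageClause_iterate_of_sectors` at
`m = dressSteps L`). [cite: Kato1949, §1] [cite: LuscherWolff1990, §2] [cite: Luscher1983, §3] -/
theorem leakageClause_dressed_of_sectors {k : ℕ} {C β : ℝ} (hβ : 0 ≤ β) (hC : 0 ≤ C) {φ : GaugeConfig 3 L SU2 → ℝ} (hφ : IsPhys φ)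
    {g : Fin k → (GaugeConfig 3 1 SU2 → ℝ)} (hg : ∀ i, IsPhys (g i))
    (h : ∀ i : Fin k, ∃ (N : ℕ) (ψ : Fin N → (GaugeConfig 3 L SU2 → ℝ)) (ev : Fin N → ℝ) (Λ a : ℝ) (j₀ : Fin N),
      (∀ j, IsPhys (ψ j)) ∧ (∀ j l, l2 (ψ j) (ψ l) = if j = l then 1 else 0) ∧
      (∀ j, transferApply β (ψ j) = ev j • ψ j) ∧ 0 ≤ Λ ∧
      (∀ χ : GaugeConfig 3 L SU2 → ℝ, IsPhys χ → (∀ j, l2 χ (ψ j) = 0) → l2 χ (transferApply β χ) ≤ Λ * l2 χ χ) ∧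
      ∑ j, (ev j - a) ^ 2 * ev j ^ (2 * dressSteps L) * l2 (liftVec β φ (g i)) (ψ j) ^ 2 +
          max (a ^ 2) ((Λ - a) ^ 2) * (Λ ^ (2 * dressSteps L) * l2 (liftVec β φ (g i)) (liftVec β φ (g i))) ≤
        C * (luscherLambda β L ^ 3 / (L : ℝ) ^ 2) * levelValue su2Rep L β 0 ^ 2 *
          (ev j₀ ^ (2 * dressSteps L) * l2 (liftVec β φ (g i)) (ψ j₀) ^ 2)) :
    LeakageClause k C β (dressedLiftFamily β φ g) :=
  leakageClause_iterate_of_sectors hβ hC (fun i => isPhys_liftVec β hφ (hg i)) (dressSteps L) h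

/-- ★★ **Hypothesis (RL) of the closing press-buttons IX∕X for ONE dressed reference lift from undressed sector data**: for physical `Ω`, `G`
(`x = liftVec β Ω G`, e.g. `G = ψ_n/Ω₁` a one-site eigen-ratio), the sector inequality at `m = dressSteps L` gives
`‖K_β v − a·v‖² ≤ ρ‖v‖²` for `v = dressedLiftVec β Ω G` — the per-vector input of `LiftLeak.liftLeakage_dressed_of_referenceLaw` (p532178) and
`LiftLeak.residualLaw_allBases_of_reference_lift_width` (p533270). [cite: ReedSimonIV1978, Thm XIII.1] [cite: LuscherWolff1990, §2] -/
theorem residual_dressedLiftVec_le_of_sectors {β : ℝ} (hβ : 0 ≤ β) {Ω : GaugeConfig 3 L SU2 → ℝ} (hΩ : IsPhys Ω)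
    {G : GaugeConfig 3 1 SU2 → ℝ} (hG : IsPhys G) {N : ℕ} {ψ : Fin N → (GaugeConfig 3 L SU2 → ℝ)} (hψ : ∀ j, IsPhys (ψ j))
    (hon : ∀ i l, l2 (ψ i) (ψ l) = if i = l then 1 else 0) (ev : Fin N → ℝ)
    (heig : ∀ j, transferApply β (ψ j) = ev j • ψ j) {Λ : ℝ} (hΛ : 0 ≤ Λ)
    (hdom : ∀ χ : GaugeConfig 3 L SU2 → ℝ, IsPhys χ → (∀ j, l2 χ (ψ j) = 0) → l2 χ (transferApply β χ) ≤ Λ * l2 χ χ)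
    {a ρ : ℝ} (hρ : 0 ≤ ρ) (j₀ : Fin N)
    (h : ∑ j, (ev j - a) ^ 2 * ev j ^ (2 * dressSteps L) * l2 (liftVec β Ω G) (ψ j) ^ 2 +
          max (a ^ 2) ((Λ - a) ^ 2) * (Λ ^ (2 * dressSteps L) * l2 (liftVec β Ω G) (liftVec β Ω G)) ≤
        ρ * (ev j₀ ^ (2 * dressSteps L) * l2 (liftVec β Ω G) (ψ j₀) ^ 2)) :
    l2 (transferApply β (dressedLiftVec β Ω G) - a • dressedLiftVec β Ω G)
        (transferApply β (dressedLiftVec β Ω G) - a • dressedLiftVec β Ω G) ≤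
      ρ * l2 (dressedLiftVec β Ω G) (dressedLiftVec β Ω G) :=
  residual_iterate_le_of_sectors hβ hψ hon ev heig hΛ hdom (isPhys_liftVec β hΩ hG) hρ (dressSteps L) j₀ h

end Dressed

/-! ## §C The hard sector is free under the stub's quantifier order `∀ lam ∃ L0 ∀ L ≥ L0` -/

section Hard

/-- **Super-exponential beats the tolerance**: for `E > 0`, `c > 0` there is `L0` with `e^{−2EL} ≤ c/L²` for all `L ≥ L0`. [folklore] -/
theorem exists_length_exp_le {E c : ℝ} (hE : 0 < E) (hc : 0 < c) :
    ∃ L0 : ℕ, ∀ L : ℕ, L0 ≤ L → Real.exp (-(2 * E * L)) ≤ c / (L : ℝ) ^ 2 := by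
  have h := (isLittleO_pow_exp_pos_mul_atTop 2 (mul_pos two_pos hE)).def hc
  have h' := (tendsto_natCast_atTop_atTop (R := ℝ)).eventually h
  obtain ⟨L0, hL0⟩ := eventually_atTop.mp h'
  refine ⟨L0 + 1, fun L hL => ?_⟩
  have hL1 : L0 ≤ L := (Nat.le_succ L0).trans hL
  have hLpos : (0 : ℝ) < L := by exact_mod_cast Nat.lt_of_lt_of_le (Nat.succ_pos L0) hL
  have hb := hL0 L hL1
  rw [Real.norm_of_nonneg (sq_nonneg _), Real.norm_of_nonneg (Real.exp_pos _).le] at hb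
  rw [le_div_iff₀ (pow_pos hLpos 2), Real.exp_neg, inv_mul_le_iff₀ (Real.exp_pos _)]
  linarith [hb]

/-- ★ **The hard sector of (o4) is free in the femto window.**  For `E > 0`, `C > 0`, `lam > 0` there is `L0` such that for all `L ≥ L0` and all `β`
in the window at level `lam` (so `λ ≥ lam`): `e^{−2·E·L}·X ≤ C·(λ³/L²)·X` for every `X ≥ 0` — e.g. `X = λ₀²·(undressed remainder weight)` with
`E = ` a fixed energy per transfer step below which only finitely many fine levels lie. [folklore] -/
theorem hardSector_le_of_window {E C lam : ℝ} (hE : 0 < E) (hC : 0 < C) (hlam : 0 < lam) :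
    ∃ L0 : ℕ, ∀ L : ℕ, L0 ≤ L → ∀ β : ℝ, InFemtoWindow lam β L → ∀ X : ℝ, 0 ≤ X →
      Real.exp (-(2 * E * L)) * X ≤ C * (luscherLambda β L ^ 3 / (L : ℝ) ^ 2) * X := by
  obtain ⟨L0, hL0⟩ := exists_length_exp_le hE (mul_pos hC (pow_pos hlam 3))
  refine ⟨L0, fun L hL β hW X hX => mul_le_mul_of_nonneg_right ?_ hX⟩
  have hlamle : lam ≤ luscherLambda β L := hW.2.1
  calc Real.exp (-(2 * E * L)) ≤ C * lam ^ 3 / (L : ℝ) ^ 2 := hL0 L hL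
    _ ≤ C * luscherLambda β L ^ 3 / (L : ℝ) ^ 2 :=
        div_le_div_of_nonneg_right (mul_le_mul_of_nonneg_left (pow_le_pow_left₀ hlam.le hlamle 3) hC.le) (sq_nonneg _)
    _ = C * (luscherLambda β L ^ 3 / (L : ℝ) ^ 2) := by ring

/-- **Damping ratio**: if the domination level sits a fixed energy `E` below a reference level, `Λ ≤ e^{−E}·μ` (`0 ≤ Λ`), then
`Λ^{2m} ≤ e^{−2Em}·μ^{2m}`. [folklore] -/
theorem pow_le_exp_mul_pow {Λ μ E : ℝ} (hΛ : 0 ≤ Λ) (h : Λ ≤ Real.exp (-E) * μ) (m : ℕ) :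
    Λ ^ (2 * m) ≤ Real.exp (-(2 * E * m)) * μ ^ (2 * m) := by
  have h1 : Λ ^ (2 * m) ≤ (Real.exp (-E) * μ) ^ (2 * m) := pow_le_pow_left₀ hΛ h _
  rw [mul_pow, ← Real.exp_nat_mul] at h1
  convert h1 using 3
  push_cast
  ring

end Hard


end Summit.QuantumFields.YangMills.Theorems.FemtoTransferGap.LiftLeak

end
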